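import Summits.BirchSwinnertonDyer.BirchSwinnertonDyer.Theorems.GenusKolyvaginAtTwoPowDvdShaCardAtTwoRTLadderCount
import Mathlib.NumberTheory.Padics.PadicVal.Basic
import HarnessLib

/-!
# Route `GenusKolyvaginAtTwo`, LINE 18 / LINE 19 (L_T `PowDvdShaCardAtTwoRT` stmt-BirchSwinnertonDyer-23242, L⁺_T
# stmt-23379), stub 3a‴ `stub_twinLadderGenus`, internal cut part (c) — THE LADDER COUNT, ABSTRACT LAYER (2/2):
# avoidance through a quotient; the one-sided and TWIN counts `2·M₀ ≤ v_p g + v_p g′ + (β₁ + β₂)`; the parity refund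

Seat `bsd-line-gk2-p3` g18 (cell `bsd-f1-sign2`), `--supports stmt-BirchSwinnertonDyer-23242` (helper; closes nothing).
THEOREMS ONLY (no definition, no named fact, no `sorry`), pure group theory over Mathlib plus the sibling file
`…RTLadderCount` (1/2: `pow_sum_dvd_natCard_of_indepFamilies`, `indepFamily_comp_of_injective`); BSD is not proved by
any of this.

* §1 `addOrderOf_map_eq_of_avoiding_ker`, `avoiding_map_of_avoiding_ker` — if a Selmer class `y` of order `N` avoids
  `⟨x⟩ + ker π` (`m • y ∈ ⟨x⟩ + ker π ⇒ N ∣ m`), then `π y` has order `N` and avoids `⟨π x⟩`: McCallum's passage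
  `c_M(n) ↦ d_M(n)` with `ker π = δ(E(K)/p^M) = ⟨δ y_K⟩` — his reason for putting `c_{M₀+N₁}(1)` into `C`.
* §2 `pow_two_mul_sum_dvd_natCard_of_ladder`, `two_mul_sum_le_padicValNat_add_of_ladder` — **one-sided count**: if
  for every `m < T` a finite group `A` carries an independent family of `2m+2` elements of order `p^{e m}` (depth-`r`
  classes avoiding any rank-`r` family: Prop. 5.2 with the `r` primes of `n` as probes bounds invariant no. `r+1`, hence
  the PAIR `r, r+1`), then `p^{2 Σ_{m<T} e m} ∣ #A`, and `2 Σ e m ≤ v_p g + β` whenever `#A ∣ p^β · g`, `g > 0`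
  (`g = #Ш(F/ℚ)[2^∞]` strict inside the `d_K`-relaxed `A`; `β` = this side's genus loss).
  `two_mul_sum_le_padicValNat_add_of_ladder_of_even` — **parity refund**: if `v_p g` is even (Cassels–Tate, tree theorem
  `WeierstrassCurve.isSquare_natCard_sha`) then `2 Σ e m ≤ v_p g + 2⌊β/2⌋`: a side losing at most one bit loses nothing.
* §2 `pow_two_mul_sum_dvd_natCard_mul_of_twinLadder`, `two_mul_sum_le_padicValNat_add_of_twinLadder`,
  `two_mul_le_padicValNat_add_of_twinLadder`, `two_mul_le_padicValNat_add_of_twinLadder_of_even` — **the twin count in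
  3a‴'s currency**: odd depths `2m+1` (exponent `a(2m) = M_{2m} − M_{2m+1}`) in `A₁ ⊇ Ш(E/ℚ)[2^∞]`, even depths `2m+2`
  (exponent `a(2m+1)`) in `A₂ ⊇ Ш(E^{d_K}/ℚ)[2^∞]`; `p^{2 Σ_{j<2T} a_j} ∣ #A₁ · #A₂`; with `#Aᵢ ∣ p^{βᵢ} gᵢ`:
  `2 · M₀ ≤ v_p g₁ + v_p g₂ + β₁ + β₂` for an antitone ladder with `M_{2T} = 0`, and with both valuations even
  `2 · M₀ ≤ v_p g₁ + v_p g₂ + 2⌊β₁/2⌋ + 2⌊β₂/2⌋`.  (McCallum's case: `Aᵢ` = the two eigenspaces of `Ш(E/K)[p^∞]`, `βᵢ = 0`.)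
READING FOR 3a‴.  What the arithmetic must still supply: (i) the families — McCallum Prop. 5.2 over `ℚ` at `2` (Q2
`KolyvaginRelationAtTwo` + Q5R + Poitou–Tate reciprocity, cyclic local groups from `CyclicFixedPartOfNegDisc`); (ii) the
losses.  Per side `βᵢ ≤ Σ_{q∣d_K} i_q = ord₂ C(Wd)` is the Ш-level form of gk2-p3 g17's relaxed/strict budget; by the
parity refund this ALREADY gives 3a‴ on the part of the frame with `ord₂ C(Wd) = 1` (the instrument's 219/262 rows:
`2M₀ ≤ ord₂ g + ord₂ g′`), and leaves exactly the joint accounting `β₁ + β₂` vs `ord₂ C(Wd) − 1` when `ord₂ C(Wd) ≥ 3`.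

References: [McCallumLMS1991] §5 (Lemma 5.1, Prop. 5.2, Thm. 5.4, Cor. 5.6; p. 310); [Kolyvagin1991MathAnn] Thm. 1.
-/

set_option autoImplicit false
-- the Theorems namespace of this sub repeats the summit name by design (D-0017 nested layout)
set_option linter.dupNamespace false

noncomputable section

open scoped Classical

namespace Summit.BirchSwinnertonDyer.BirchSwinnertonDyer.Theorems.GenusExact.PlusDescent

universe u v

/-! ## §1 Avoidance passes to a quotient (`c ↦ d`, kernel `δE(ℚ)`) -/

section Quotient

variable {S : Type u} {B : Type v} [AddCommGroup S] [AddCommGroup B]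

/-- If `y` has order `N` and avoids `⟨x⟩ + ker π` (`m • y ∈ ⟨x⟩ + ker π ⇒ N ∣ m`), then `π y` still has order `N`.
(In McCallum's setting: `π : Sel_{p^M} → H¹(K,E)[p^M]`, `ker π = δ(E(K)/p^M) = ⟨δ y_K⟩`, and the class `d_M(n) = π c_M(n)`
has the same order as `c_M(n)` as soon as `⟨c_M(n)⟩` meets `C ⊇ ⟨c_{M}(1)⟩` trivially — his reason for putting
`c_{M₀+N₁}(1)` into `C`.) [cite: McCallumLMS1991, Thm. 5.4 (proof)] -/
theorem addOrderOf_map_eq_of_avoiding_ker (π : S →+ B) {N i : ℕ} (x : Fin i → S) (y : S)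
    (hy : addOrderOf y = N)
    (hav : ∀ (m : ℤ) (c : Fin i → ℤ) (z : S), z ∈ π.ker → m • y = ∑ k, c k • x k + z → (N : ℤ) ∣ m) :
    addOrderOf (π y) = N := by
  refine Nat.dvd_antisymm ?_ ?_
  · refine addOrderOf_dvd_of_nsmul_eq_zero ?_
    rw [← map_nsmul, ← hy, addOrderOf_nsmul_eq_zero, map_zero]
  · have h := hav (addOrderOf (π y)) (fun _ => 0) ((addOrderOf (π y) : ℤ) • y) ?_ ?_
    · exact Int.natCast_dvd_natCast.mp h
    · rw [AddMonoidHom.mem_ker, map_zsmul, natCast_zsmul, addOrderOf_nsmul_eq_zero]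
    · simp
/-- If `y` avoids `⟨x⟩ + ker π` with exponent `N`, then `π y` avoids `⟨π x⟩` with exponent `N`. [cite: McCallumLMS1991, Thm. 5.4 (proof)] -/
theorem avoiding_map_of_avoiding_ker (π : S →+ B) {N i : ℕ} (x : Fin i → S) (y : S)
    (hav : ∀ (m : ℤ) (c : Fin i → ℤ) (z : S), z ∈ π.ker → m • y = ∑ k, c k • x k + z → (N : ℤ) ∣ m) :
    ∀ (m : ℤ) (c : Fin i → ℤ), m • π y = ∑ k, c k • π (x k) → (N : ℤ) ∣ m := by
  intro m c h
  refine hav m c (m • y - ∑ k, c k • x k) ?_ (by abel)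
  rw [AddMonoidHom.mem_ker, map_sub, map_zsmul, map_sum, h]
  simp only [map_zsmul, sub_self]

end Quotient

/-! ## §2 The ladder and twin counts in the currency of 3a‴ -/

section Twin

/-- `∑_{j<2T} f j = ∑_{m<T} (f (2m) + f (2m+1))`. [folklore] -/
theorem sum_range_two_mul (f : ℕ → ℕ) (T : ℕ) :
    ∑ j ∈ Finset.range (2 * T), f j = ∑ m ∈ Finset.range T, (f (2 * m) + f (2 * m + 1)) := by
  induction T with
  | zero => simp
  | succ T ih =>
    rw [show 2 * (T + 1) = 2 * T + 1 + 1 by ring, Finset.sum_range_succ, Finset.sum_range_succ, ih,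
      Finset.sum_range_succ]
    ring

/-- Telescoping of an antitone ladder: `∑_{j<n} (M j − M (j+1)) = M 0 − M n`. [folklore] -/
theorem sum_range_sub_eq_of_antitone (M : ℕ → ℕ) (hM : ∀ j, M (j + 1) ≤ M j) (n : ℕ) :
    ∑ j ∈ Finset.range n, (M j - M (j + 1)) = M 0 - M n := by
  have hmono : ∀ n, M n ≤ M 0 := fun n => by
    induction n with
    | zero => exact le_rfl
    | succ n ih => exact (hM n).trans ih
  induction n with
  | zero => simp
  | succ n ih =>
    rw [Finset.sum_range_succ, ih]
    have h1 := hM n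
    have h2 := hmono n
    omega

variable {A : Type u} [AddCommGroup A]

/-- **One-sided ladder count (divisibility form).**  If for every `m < T` the finite group `A` carries an independent
family of `2m+2` elements of order `p^{e m}`, then `p^{2 Σ_{m<T} e m} ∣ #A` (the count of §3 with
`b_{2m} = b_{2m+1} = e m`: both the `(2m+1)`-st and the `(2m+2)`-nd invariant are `≥ e m`).  McCallum: in the
eigenspace `Ш(E/K)[p^∞]^{ε_r}` the depth-`r` classes `d_{M_{r−1}}(n)`, `n ∈ S_r(M_{r−1})`, avoiding any subgroup of
rank `r` (Prop. 5.2 with the `r` primes of `n` as probes) give such families with `e = M_{r−1} − M_r`, whence the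
SQUARE `(ℤ/p^{M_{r−1}−M_r})²` without any use of the Cassels–Tate pairing. [cite: McCallumLMS1991, §5 (p. 310), Prop. 5.2] -/
theorem pow_two_mul_sum_dvd_natCard_of_ladder [Finite A] {p : ℕ} (hp : p.Prime) (T : ℕ) (e : ℕ → ℕ)
    (hfam : ∀ m < T, ∃ x : Fin (2 * m + 2) → A, (∀ i, addOrderOf (x i) = p ^ e m) ∧
      ∀ c : Fin (2 * m + 2) → ℤ, ∑ i, c i • x i = 0 → ∀ i, ((p ^ e m : ℕ) : ℤ) ∣ c i) :
    p ^ (2 * ∑ m ∈ Finset.range T, e m) ∣ Nat.card A := by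
  -- `b j = e (j/2)`; restrict the family of size `2(j/2)+2` to its first `j+1` members
  have h : p ^ (∑ j ∈ Finset.range (2 * T), e (j / 2)) ∣ Nat.card A := by
    refine pow_sum_dvd_natCard_of_indepFamilies hp (fun j => e (j / 2)) fun j hj => ?_
    obtain ⟨x, hord, hind⟩ := hfam (j / 2) (by omega)
    have hle : j + 1 ≤ 2 * (j / 2) + 2 := by omega
    exact ⟨fun i => x (Fin.castLE hle i), fun i => hord _,
      indepFamily_comp_of_injective x hind (Fin.castLE hle) (Fin.castLE_injective hle)⟩
  have hsum : ∑ j ∈ Finset.range (2 * T), e (j / 2) = 2 * ∑ m ∈ Finset.range T, e m := by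
    rw [sum_range_two_mul, Finset.mul_sum]
    refine Finset.sum_congr rfl fun m _ => ?_
    have h1 : 2 * m / 2 = m := by omega
    have h2 : (2 * m + 1) / 2 = m := by omega
    rw [h1, h2]
    ring
  rwa [hsum] at h

/-- **One-sided ladder count (valuation form).**  If moreover `#A ∣ p^β · g` with `g > 0` (LINE 18: `g = #Ш(F/ℚ)[2^∞]`
for the strict group inside the `d_K`-relaxed group `A`, `p^β` the index — the genus loss of this side), then
`2 Σ_{m<T} e m ≤ v_p g + β`. [cite: McCallumLMS1991, §5 (p. 310)] -/
theorem two_mul_sum_le_padicValNat_add_of_ladder {p : ℕ} [hp : Fact p.Prime] (T : ℕ) (e : ℕ → ℕ) {g β : ℕ}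
    (hg : 0 < g) (hβ : Nat.card A ∣ p ^ β * g)
    (hfam : ∀ m < T, ∃ x : Fin (2 * m + 2) → A, (∀ i, addOrderOf (x i) = p ^ e m) ∧
      ∀ c : Fin (2 * m + 2) → ℤ, ∑ i, c i • x i = 0 → ∀ i, ((p ^ e m : ℕ) : ℤ) ∣ c i) :
    2 * ∑ m ∈ Finset.range T, e m ≤ padicValNat p g + β := by
  have hp' := hp.out
  have hne : p ^ β * g ≠ 0 := mul_ne_zero (pow_ne_zero _ hp'.ne_zero) hg.ne'
  haveI : Finite A := Nat.finite_of_card_ne_zero (fun h => hne (Nat.eq_zero_of_zero_dvd (h ▸ hβ)))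
  have h := (pow_two_mul_sum_dvd_natCard_of_ladder hp' T e hfam).trans hβ
  have hle := (padicValNat_dvd_iff_le hne).mp h
  rw [padicValNat.mul (pow_ne_zero _ hp'.ne_zero) hg.ne', padicValNat.prime_pow] at hle
  omega

/-- **Parity refund.**  If in addition `v_p g` is EVEN (for `g = #Ш(F/ℚ)[2^∞]`: Cassels–Tate, tree theorem
`WeierstrassCurve.isSquare_natCard_sha`), an odd loss is rounded away: `2 Σ_{m<T} e m ≤ v_p g + 2⌊β/2⌋`.  So a side
whose genus loss is at most one bit loses NOTHING. [cite: McCallumLMS1991, §5 (p. 310)] -/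
theorem two_mul_sum_le_padicValNat_add_of_ladder_of_even {p : ℕ} [hp : Fact p.Prime] (T : ℕ) (e : ℕ → ℕ)
    {g β : ℕ} (hg : 0 < g) (hβ : Nat.card A ∣ p ^ β * g) (heven : Even (padicValNat p g))
    (hfam : ∀ m < T, ∃ x : Fin (2 * m + 2) → A, (∀ i, addOrderOf (x i) = p ^ e m) ∧
      ∀ c : Fin (2 * m + 2) → ℤ, ∑ i, c i • x i = 0 → ∀ i, ((p ^ e m : ℕ) : ℤ) ∣ c i) :
    2 * ∑ m ∈ Finset.range T, e m ≤ padicValNat p g + 2 * (β / 2) := by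
  have h := two_mul_sum_le_padicValNat_add_of_ladder T e hg hβ hfam
  obtain ⟨v, hv⟩ := heven
  omega

variable {Ap : Type u} {Am : Type v} [AddCommGroup Ap] [AddCommGroup Am]

/-- **Twin ladder count (divisibility form).**  Let `p` be prime and `A₁`, `A₂` finite additive commutative groups
(the variables `Ap`, `Am`).  Suppose that for every `m < T` there are an independent family of `2m+2` elements of order
`p^{a(2m)}` in `A₁` (McCallum: depth `2m+1` classes, Prop. 5.2 with all `2m+1` primes as probes ⇒ invariant no. `2m+2`)
and an independent family of `2m+2` elements of order `p^{a(2m+1)}` in `A₂` (depth `2m+2`, one probe spent on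
`δE(K)`).  Then `p^{2 Σ_{j<2T} a j} ∣ #A₁ · #A₂`.  (McCallum's case: `A₁, A₂ = Ш(E/K)[p^∞]^{−ε}, Ш(E/K)[p^∞]^{ε}`,
`a j = M_j − M_{j+1}`; LINE 18's case: `A₁ ⊇ Ш(E/ℚ)[2^∞]`, `A₂ ⊇ Ш(E^{d_K}/ℚ)[2^∞]` the `d_K`-relaxed groups.)
[cite: McCallumLMS1991, §5 (p. 310), Thm. 5.4] -/
theorem pow_two_mul_sum_dvd_natCard_mul_of_twinLadder [Finite Ap] [Finite Am] {p : ℕ} (hp : p.Prime) (T : ℕ)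
    (a : ℕ → ℕ)
    (hodd : ∀ m < T, ∃ x : Fin (2 * m + 2) → Ap, (∀ i, addOrderOf (x i) = p ^ a (2 * m)) ∧
      ∀ c : Fin (2 * m + 2) → ℤ, ∑ i, c i • x i = 0 → ∀ i, ((p ^ a (2 * m) : ℕ) : ℤ) ∣ c i)
    (heven : ∀ m < T, ∃ x : Fin (2 * m + 2) → Am, (∀ i, addOrderOf (x i) = p ^ a (2 * m + 1)) ∧
      ∀ c : Fin (2 * m + 2) → ℤ, ∑ i, c i • x i = 0 → ∀ i, ((p ^ a (2 * m + 1) : ℕ) : ℤ) ∣ c i) :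
    p ^ (2 * ∑ j ∈ Finset.range (2 * T), a j) ∣ Nat.card Ap * Nat.card Am := by
  have hplus := pow_two_mul_sum_dvd_natCard_of_ladder hp T (fun m => a (2 * m)) hodd
  have hminus := pow_two_mul_sum_dvd_natCard_of_ladder hp T (fun m => a (2 * m + 1)) heven
  have hsum : 2 * ∑ m ∈ Finset.range T, a (2 * m) + 2 * ∑ m ∈ Finset.range T, a (2 * m + 1) =
      2 * ∑ j ∈ Finset.range (2 * T), a j := by
    rw [sum_range_two_mul, ← mul_add, ← Finset.sum_add_distrib]
  rw [← hsum, pow_add]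
  exact mul_dvd_mul hplus hminus

/-- **Twin ladder count (valuation form, 3a‴'s currency).**  With `p` prime, positive naturals `g₁, g₂`
(`#Ш(E/ℚ)[2^∞]`, `#Ш(E^{d_K}/ℚ)[2^∞]`), groups `A₁, A₂` with `#Aᵢ ∣ p^{βᵢ} · gᵢ` (the `d_K`-relaxed groups; `βᵢ` the genus
losses), and the two ladders of independent families in `A₁, A₂` as in
`pow_two_mul_sum_dvd_natCard_mul_of_twinLadder`: `2 Σ_{j<2T} a j ≤ v_p g₁ + v_p g₂ + β₁ + β₂`.
[cite: McCallumLMS1991, §5 (p. 310), Thm. 5.4] -/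
theorem two_mul_sum_le_padicValNat_add_of_twinLadder {p : ℕ} [hp : Fact p.Prime] (T : ℕ) (a : ℕ → ℕ)
    {g₁ g₂ β₁ β₂ : ℕ} (hg₁ : 0 < g₁) (hg₂ : 0 < g₂)
    (hβ₁ : Nat.card Ap ∣ p ^ β₁ * g₁) (hβ₂ : Nat.card Am ∣ p ^ β₂ * g₂)
    (hodd : ∀ m < T, ∃ x : Fin (2 * m + 2) → Ap, (∀ i, addOrderOf (x i) = p ^ a (2 * m)) ∧
      ∀ c : Fin (2 * m + 2) → ℤ, ∑ i, c i • x i = 0 → ∀ i, ((p ^ a (2 * m) : ℕ) : ℤ) ∣ c i)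
    (heven : ∀ m < T, ∃ x : Fin (2 * m + 2) → Am, (∀ i, addOrderOf (x i) = p ^ a (2 * m + 1)) ∧
      ∀ c : Fin (2 * m + 2) → ℤ, ∑ i, c i • x i = 0 → ∀ i, ((p ^ a (2 * m + 1) : ℕ) : ℤ) ∣ c i) :
    2 * ∑ j ∈ Finset.range (2 * T), a j ≤ padicValNat p g₁ + padicValNat p g₂ + β₁ + β₂ := by
  have h₁ := two_mul_sum_le_padicValNat_add_of_ladder T (fun m => a (2 * m)) hg₁ hβ₁ hodd
  have h₂ := two_mul_sum_le_padicValNat_add_of_ladder T (fun m => a (2 * m + 1)) hg₂ hβ₂ heven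
  have hsum : 2 * ∑ m ∈ Finset.range T, a (2 * m) + 2 * ∑ m ∈ Finset.range T, a (2 * m + 1) =
      2 * ∑ j ∈ Finset.range (2 * T), a j := by
    rw [sum_range_two_mul, ← mul_add, ← Finset.sum_add_distrib]
  omega

/-- **Twin ladder count for an antitone ladder `M` (the shape of 3a‴).**  With `a j = M j − M (j+1)`, `M` antitone and
`M (2T) = 0`: `2 · M 0 ≤ v_p g₁ + v_p g₂ + β₁ + β₂` — i.e. `2M₀ ≤ ord_p g + ord_p g′ + (β₁ + β₂)`, the inequality of
LINE 18's `stub_twinLadderGenus` with the genus defect `ord₂ C(Wd) − 1` replaced by the abstract losses `β₁ + β₂`; the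
arithmetic still owed is (i) the families (McCallum Prop. 5.2 over `ℚ` at `2`: Q2 + Q5R + reciprocity) and (ii) the
size of `β₁ + β₂`. [cite: McCallumLMS1991, §5 Lemma 5.1, Thm. 5.4, Cor. 5.6] -/
theorem two_mul_le_padicValNat_add_of_twinLadder {p : ℕ} [hp : Fact p.Prime] (T : ℕ) (M : ℕ → ℕ)
    (hM : ∀ j, M (j + 1) ≤ M j) (hMT : M (2 * T) = 0)
    {g₁ g₂ β₁ β₂ : ℕ} (hg₁ : 0 < g₁) (hg₂ : 0 < g₂)
    (hβ₁ : Nat.card Ap ∣ p ^ β₁ * g₁) (hβ₂ : Nat.card Am ∣ p ^ β₂ * g₂)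
    (hodd : ∀ m < T, ∃ x : Fin (2 * m + 2) → Ap, (∀ i, addOrderOf (x i) = p ^ (M (2 * m) - M (2 * m + 1))) ∧
      ∀ c : Fin (2 * m + 2) → ℤ, ∑ i, c i • x i = 0 →
        ∀ i, ((p ^ (M (2 * m) - M (2 * m + 1)) : ℕ) : ℤ) ∣ c i)
    (heven : ∀ m < T, ∃ x : Fin (2 * m + 2) → Am,
      (∀ i, addOrderOf (x i) = p ^ (M (2 * m + 1) - M (2 * m + 2))) ∧
      ∀ c : Fin (2 * m + 2) → ℤ, ∑ i, c i • x i = 0 →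
        ∀ i, ((p ^ (M (2 * m + 1) - M (2 * m + 2)) : ℕ) : ℤ) ∣ c i) :
    2 * M 0 ≤ padicValNat p g₁ + padicValNat p g₂ + β₁ + β₂ := by
  have h := two_mul_sum_le_padicValNat_add_of_twinLadder (Ap := Ap) (Am := Am) T
    (fun j => M j - M (j + 1)) hg₁ hg₂ hβ₁ hβ₂ hodd heven
  rw [sum_range_sub_eq_of_antitone M hM, hMT, Nat.sub_zero] at h
  exact h

/-- **Twin count with parity refund.**  With `v_p g₁`, `v_p g₂` EVEN (Cassels–Tate over `ℚ` for `E` and `E^{d_K}`) each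
side rounds its own odd loss away: `2 · M 0 ≤ v_p g₁ + v_p g₂ + 2⌊β₁/2⌋ + 2⌊β₂/2⌋`.  CONSEQUENCE FOR 3a‴: on the part of
the frame where each side loses at most ONE bit (`β₁, β₂ ≤ 1` — e.g. when the genus budget `ord₂ C(Wd) = Σ_{q∣d_K} i_q`
is `1`, the instrument's 219/262 rows), `2M₀ ≤ ord₂ g + ord₂ g′` outright, which is 3a‴ there (`ord₂ C(Wd) − 1 = 0`):
no joint accounting of the two sides is needed, only the families. [cite: McCallumLMS1991, §5 Thm. 5.4, Cor. 5.6] -/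
theorem two_mul_le_padicValNat_add_of_twinLadder_of_even {p : ℕ} [hp : Fact p.Prime] (T : ℕ) (M : ℕ → ℕ)
    (hM : ∀ j, M (j + 1) ≤ M j) (hMT : M (2 * T) = 0)
    {g₁ g₂ β₁ β₂ : ℕ} (hg₁ : 0 < g₁) (hg₂ : 0 < g₂)
    (hβ₁ : Nat.card Ap ∣ p ^ β₁ * g₁) (hβ₂ : Nat.card Am ∣ p ^ β₂ * g₂)
    (hev₁ : Even (padicValNat p g₁)) (hev₂ : Even (padicValNat p g₂))
    (hodd : ∀ m < T, ∃ x : Fin (2 * m + 2) → Ap, (∀ i, addOrderOf (x i) = p ^ (M (2 * m) - M (2 * m + 1))) ∧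
      ∀ c : Fin (2 * m + 2) → ℤ, ∑ i, c i • x i = 0 →
        ∀ i, ((p ^ (M (2 * m) - M (2 * m + 1)) : ℕ) : ℤ) ∣ c i)
    (heven : ∀ m < T, ∃ x : Fin (2 * m + 2) → Am,
      (∀ i, addOrderOf (x i) = p ^ (M (2 * m + 1) - M (2 * m + 2))) ∧
      ∀ c : Fin (2 * m + 2) → ℤ, ∑ i, c i • x i = 0 →
        ∀ i, ((p ^ (M (2 * m + 1) - M (2 * m + 2)) : ℕ) : ℤ) ∣ c i) :
    2 * M 0 ≤ padicValNat p g₁ + padicValNat p g₂ + 2 * (β₁ / 2) + 2 * (β₂ / 2) := by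
  have h₁ := two_mul_sum_le_padicValNat_add_of_ladder_of_even T (fun m => M (2 * m) - M (2 * m + 1)) hg₁ hβ₁
    hev₁ hodd
  have h₂ := two_mul_sum_le_padicValNat_add_of_ladder_of_even T (fun m => M (2 * m + 1) - M (2 * m + 2)) hg₂
    hβ₂ hev₂ heven
  have hsum : 2 * ∑ m ∈ Finset.range T, (M (2 * m) - M (2 * m + 1)) +
      2 * ∑ m ∈ Finset.range T, (M (2 * m + 1) - M (2 * m + 2)) =
      2 * ∑ j ∈ Finset.range (2 * T), (M j - M (j + 1)) := by
    rw [sum_range_two_mul (fun j => M j - M (j + 1)), ← mul_add, ← Finset.sum_add_distrib]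
  rw [sum_range_sub_eq_of_antitone M hM, hMT, Nat.sub_zero] at hsum
  omega

end Twin

end Summit.BirchSwinnertonDyer.BirchSwinnertonDyer.Theorems.GenusExact.PlusDescent

end
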